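import Mathlib
import Summits.Ventures.PercRepro2.Defs
import Summits.Ventures.PercRepro2.Independence
import Summits.Ventures.PercRepro2.Harris
import Summits.Ventures.PercRepro2.Graph
import Summits.Ventures.PercRepro2.Exploration
import Summits.Ventures.PercRepro2.Events
import Summits.Ventures.PercRepro2.HCov
import Summits.Ventures.PercRepro2.HCovFns
import Summits.Ventures.PercRepro2.HCovSwap
import Summits.Ventures.PercRepro2.PendantRoot
import Summits.Ventures.PercRepro2.PendantO
import Summits.Ventures.PercRepro2.PendantB
import Summits.Ventures.PercRepro2.PendantBRow
import Summits.Ventures.PercRepro2.LeafStep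
import Summits.Ventures.PercRepro2.LeafStepT0
import Summits.Ventures.PercRepro2.LeafChain
import Summits.Ventures.PercRepro2.LeafEnds
import Summits.Ventures.PercRepro2.LeafPlus

/-!
# Deleting a leaf, and the CORRECTED composition of leaf steps along a pendant path
(blind cell PercRepro2, p1 g8; correction of `LeafChain.HCov_pendant_path` and
`LeafEnds.HCov_pendant_path_{o,b,root}`, INBOX 2026-08-23T21:5xZ)

The landed pendant-PATH theorems assume, in ONE graph, that `a₃` is a leaf at `v` (`hleaf₃`) and
that `v` is a leaf at `w` (`hleafv : ∀ e, v ∈ ends e → e = g`); since `v ∈ ends f`, this forces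
`f = g` and `a₃ = w`, so their hypotheses are inconsistent (`pendant_path_hyps_absurd`). The
one-step theorems are fine; the composition must apply the second step in `G − a₃`.

**Leaf deletion by re-pointing.** For a leaf `a₃` with edge `f = s(a₃, v)`, let
`ends′ := Function.update ends f s(a₃, a₃)` (the leaf edge becomes a loop at `a₃`; same edge set,
same weights, same measure). Then
* connections among vertices `≠ a₃` are unchanged (`conn_update_loop_iff`: a path may visit the
  dead end `a₃` only through `f` and must come back through `f`; closure argument as in
  `conn_of_conn_of_eq_off_leaf`), so every event and every mass of a marking avoiding `a₃` is
  unchanged — `Gc`, `R½`, `T₀`, `CovC`, hence `HCov`, `LeafRow`, `Q1Row`, `HCovTriple`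
  (`HCov_update_loop`, `LeafRow_update_loop`, `Q1Row_update_loop`);
* `v` IS a leaf in `ends′` when its edges in `ends` are `f` and `g` (`leaf_update_loop`).

**Corrected path theorems**: with `hdeg : ∀ e, v ∈ ends e → e = g ∨ e = f` (the intermediate
vertex has degree two), `HCov_pendant_path'` composes the one-step theorems in `ends′` (at `v`)
and in `ends` (at `a₃`);
pendant paths of ANY length are in `LeafDeletePath.lean` (the list predicate `PendantPath`) and the
`(HCOV)⁺`-triple versions in `LeafDeleteTriple.lean`. Finally `Q1_expr_eq` / `Q1Row_iff_margin`:
`(Q1)` at `v` is the leaf row with the margin `½ · P(Q, v ∉ U)/P(Q) · T₀`.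
-/

namespace Summit.Ventures.PercRepro2

open UnionCluster CovForm PendantRoot PendantO LeafStep

namespace LeafDelete

variable {V : Type*} {E : Type*}

/-- The hypotheses of `LeafChain.HCov_pendant_path` (a leaf `a₃` at `v` AND `v` a leaf at `w`, in the
same graph) are inconsistent when `a₃ ≠ w`. -/
theorem pendant_path_hyps_absurd {ends : E → Sym2 V} {f g : E} {a₃ v w : V}
    (hf : ends f = s(a₃, v)) (hg : ends g = s(v, w)) (hleafv : ∀ e, v ∈ ends e → e = g)
    (h3v : a₃ ≠ v) (h3w : a₃ ≠ w) : False := by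
  have hvf : v ∈ ends f := by rw [hf]; exact Sym2.mem_mk_right _ _
  have hfg : f = g := hleafv f hvf
  rw [hfg, hg] at hf
  rw [Sym2.eq_iff] at hf
  rcases hf with ⟨h1, _⟩ | ⟨_, h2⟩
  · exact h3v h1.symm
  · exact h3w h2.symm

section Conn

variable [DecidableEq E] {ends : E → Sym2 V} {f : E} {a₃ v : V}

/-- Connections in the re-pointed graph are connections in the original graph. -/
lemma conn_of_conn_update_loop {ω : Config E} {x y : V}
    (h : Conn (Function.update ends f s(a₃, a₃)) ω x y) : Conn ends ω x y := by
  let S : Set V := {z | Conn ends ω x z}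
  have hS : ∀ z ∈ S, ∀ z', (openGraph (Function.update ends f s(a₃, a₃)) ω).Adj z z' → z' ∈ S := by
    intro z hz z' hzz'
    obtain ⟨hne, e, he, hends⟩ := openGraph_adj.1 hzz'
    by_cases hef : e = f
    · subst hef
      rw [Function.update_self] at hends
      rw [Sym2.eq_iff] at hends
      rcases hends with ⟨h1, h2⟩ | ⟨h1, h2⟩
      · exact absurd (h1.symm.trans h2) hne
      · exact absurd (h2.symm.trans h1) hne
    · rw [Function.update_of_ne hef] at hends
      exact conn_trans hz (conn_of_openAdj ⟨e, he, hends⟩)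
  exact mem_of_conn_of_closed hS (conn_refl ends ω x) h

/-- Connections among vertices other than the leaf are connections in the re-pointed graph. -/
lemma conn_update_loop_of_conn (hf : ends f = s(a₃, v)) (hleaf : ∀ e, a₃ ∈ ends e → e = f)
    (h3v : a₃ ≠ v) {ω : Config E} {x y : V} (hx : x ≠ a₃) (hy : y ≠ a₃) (h : Conn ends ω x y) :
    Conn (Function.update ends f s(a₃, a₃)) ω x y := by
  set ends' := Function.update ends f s(a₃, a₃) with hends'
  let S : Set V := {z | (z ≠ a₃ ∧ Conn ends' ω x z) ∨ (z = a₃ ∧ Conn ends' ω x v)}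
  have hS : ∀ z ∈ S, ∀ z', (openGraph ends ω).Adj z z' → z' ∈ S := by
    intro z hz z' hzz'
    obtain ⟨hne, e, he, hends⟩ := openGraph_adj.1 hzz'
    by_cases hef : e = f
    · subst hef
      rw [hf, Sym2.eq_iff] at hends
      rcases hends with ⟨h1, h2⟩ | ⟨h1, h2⟩
      · -- `z = a₃`, `z' = v`
        subst h1; subst h2
        rcases hz with ⟨h3, _⟩ | ⟨_, hv⟩
        · exact absurd rfl h3
        · exact Or.inl ⟨h3v.symm, hv⟩
      · -- `z = v`, `z' = a₃`
        subst h1; subst h2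
        rcases hz with ⟨_, hv⟩ | ⟨h3, _⟩
        · exact Or.inr ⟨rfl, hv⟩
        · exact absurd h3.symm h3v
    · have hz3 : z ≠ a₃ := by
        rintro rfl
        exact hef (hleaf e (by rw [hends]; exact Sym2.mem_mk_left _ _))
      have hz'3 : z' ≠ a₃ := by
        rintro rfl
        exact hef (hleaf e (by rw [hends]; exact Sym2.mem_mk_right _ _))
      have hzc : Conn ends' ω x z := by
        rcases hz with ⟨_, hc⟩ | ⟨h3, _⟩
        · exact hc
        · exact absurd h3 hz3
      have hadj : OpenAdj ends' ω z z' := ⟨e, he, by rw [hends', Function.update_of_ne hef]; exact hends⟩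
      exact Or.inl ⟨hz'3, conn_trans hzc (conn_of_openAdj hadj)⟩
  have hxS : x ∈ S := Or.inl ⟨hx, conn_refl ends' ω x⟩
  have hyS := mem_of_conn_of_closed hS hxS h
  rcases hyS with ⟨_, hc⟩ | ⟨h3, _⟩
  · exact hc
  · exact absurd h3 hy

/-- **Leaf deletion**: for `x, y ≠ a₃`, `x ↔ y` in the re-pointed graph iff in the original one. -/
lemma conn_update_loop_iff (hf : ends f = s(a₃, v)) (hleaf : ∀ e, a₃ ∈ ends e → e = f)
    (h3v : a₃ ≠ v) {ω : Config E} {x y : V} (hx : x ≠ a₃) (hy : y ≠ a₃) :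
    Conn (Function.update ends f s(a₃, a₃)) ω x y ↔ Conn ends ω x y :=
  ⟨conn_of_conn_update_loop, conn_update_loop_of_conn hf hleaf h3v hx hy⟩

/-- The connection event of two vertices other than the leaf is unchanged. -/
lemma connEvent_update_loop (hf : ends f = s(a₃, v)) (hleaf : ∀ e, a₃ ∈ ends e → e = f)
    (h3v : a₃ ≠ v) {x y : V} (hx : x ≠ a₃) (hy : y ≠ a₃) :
    connEvent (Function.update ends f s(a₃, a₃)) x y = connEvent ends x y := by
  ext ω
  exact conn_update_loop_iff hf hleaf h3v hx hy

/-- `Q` is unchanged. -/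
lemma avoidAll_update_loop (hf : ends f = s(a₃, v)) (hleaf : ∀ e, a₃ ∈ ends e → e = f)
    (h3v : a₃ ≠ v) {a₁ a₂ : V} (h1 : a₁ ≠ a₃) (h2 : a₂ ≠ a₃) :
    avoidAll (Function.update ends f s(a₃, a₃)) a₂ {a₁} = avoidAll ends a₂ {a₁} := by
  ext ω
  simp only [avoidAll, Set.mem_setOf_eq, Finset.mem_singleton, forall_eq]
  rw [conn_update_loop_iff hf hleaf h3v h2 h1]

/-- `T` is unchanged. -/
lemma TEvent_update_loop (hf : ends f = s(a₃, v)) (hleaf : ∀ e, a₃ ∈ ends e → e = f)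
    (h3v : a₃ ≠ v) {a₁ a₂ w : V} (h1 : a₁ ≠ a₃) (h2 : a₂ ≠ a₃) (hw : w ≠ a₃) :
    TEvent (Function.update ends f s(a₃, a₃)) a₁ a₂ w = TEvent ends a₁ a₂ w := by
  unfold TEvent
  rw [connEvent_update_loop hf hleaf h3v h2 h1, connEvent_update_loop hf hleaf h3v h2 hw]

/-- `PD` is unchanged. -/
lemma PDEvent_update_loop (hf : ends f = s(a₃, v)) (hleaf : ∀ e, a₃ ∈ ends e → e = f)
    (h3v : a₃ ≠ v) {a₁ a₂ w : V} (h1 : a₁ ≠ a₃) (h2 : a₂ ≠ a₃) (hw : w ≠ a₃) :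
    PDEvent (Function.update ends f s(a₃, a₃)) a₁ a₂ w = PDEvent ends a₁ a₂ w := by
  unfold PDEvent Dtilde UnionCluster.inU
  rw [connEvent_update_loop hf hleaf h3v h1 h2, connEvent_update_loop hf hleaf h3v hw h1,
    connEvent_update_loop hf hleaf h3v hw h2]

/-- In the re-pointed graph the attachment vertex `v` of degree two is a leaf. -/
lemma leaf_update_loop (hf : ends f = s(a₃, v)) (h3v : a₃ ≠ v) {g : E}
    (hdeg : ∀ e, v ∈ ends e → e = g ∨ e = f) :
    ∀ e, v ∈ Function.update ends f s(a₃, a₃) e → e = g := by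
  intro e he
  by_cases hef : e = f
  · subst hef
    rw [Function.update_self, Sym2.mem_iff] at he
    rcases he with h | h <;> exact absurd h.symm h3v
  · rw [Function.update_of_ne hef] at he
    rcases hdeg e he with h | h
    · exact h
    · exact absurd h hef

/-- The other edge of `v` is not the leaf edge, and keeps its ends. -/
lemma ends_update_loop_of_ne (hf : ends f = s(a₃, v)) (h3v : a₃ ≠ v) {g : E} {w : V}
    (hg : ends g = s(v, w)) (h3w : a₃ ≠ w) :
    Function.update ends f s(a₃, a₃) g = s(v, w) := by
  have hgf : g ≠ f := by
    rintro rfl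
    rw [hf, Sym2.eq_iff] at hg
    rcases hg with ⟨h1, _⟩ | ⟨h1, _⟩
    · exact h3v h1
    · exact h3w h1
  rw [Function.update_of_ne hgf, hg]

end Conn

section Masses

variable [Fintype E] [DecidableEq E] {R : Type*} [Field R] [LinearOrder R]
  [IsStrictOrderedRing R] (p : E → R) {ends : E → Sym2 V} {f : E} {a₃ v : V}

omit [LinearOrder R] [IsStrictOrderedRing R] in
/-- `Gc` at a marking avoiding the leaf is unchanged by leaf deletion. -/
lemma Gc_update_loop (hf : ends f = s(a₃, v)) (hleaf : ∀ e, a₃ ∈ ends e → e = f) (h3v : a₃ ≠ v)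
    {o a₁ a₂ w b : V} (ho : o ≠ a₃) (h1 : a₁ ≠ a₃) (h2 : a₂ ≠ a₃) (hw : w ≠ a₃) (hb : b ≠ a₃) :
    Gc p (Function.update ends f s(a₃, a₃)) o a₁ a₂ w b = Gc p ends o a₁ a₂ w b := by
  unfold Gc DEF EQbo EQb3 EQb3o EQo EQ3 EQ3o PDb PDbo Do gap
  simp only [connEvent_update_loop hf hleaf h3v, avoidAll_update_loop hf hleaf h3v,
    TEvent_update_loop hf hleaf h3v, PDEvent_update_loop hf hleaf h3v, ho, h1, h2, hw, hb,
    ne_eq, not_false_eq_true]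

omit [LinearOrder R] [IsStrictOrderedRing R] in
/-- `R½` at a marking avoiding the leaf is unchanged by leaf deletion. -/
lemma Rhalf_update_loop (hf : ends f = s(a₃, v)) (hleaf : ∀ e, a₃ ∈ ends e → e = f) (h3v : a₃ ≠ v)
    {o a₁ a₂ w b : V} (ho : o ≠ a₃) (h1 : a₁ ≠ a₃) (h2 : a₂ ≠ a₃) (hw : w ≠ a₃) (hb : b ≠ a₃) :
    Rhalf p (Function.update ends f s(a₃, a₃)) o a₁ a₂ w b = Rhalf p ends o a₁ a₂ w b := by
  unfold Rhalf T0 Gc1 mU mUU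
  unfold EQbo EQb3 EQb3o EQo EQ3 EQ3o PDb PDbo Do gap
  simp only [connEvent_update_loop hf hleaf h3v, avoidAll_update_loop hf hleaf h3v,
    TEvent_update_loop hf hleaf h3v, PDEvent_update_loop hf hleaf h3v, ho, h1, h2, hw, hb,
    ne_eq, not_false_eq_true]

omit [LinearOrder R] [IsStrictOrderedRing R] in
/-- `T₀` at a marking avoiding the leaf is unchanged by leaf deletion. -/
lemma T0_update_loop (hf : ends f = s(a₃, v)) (hleaf : ∀ e, a₃ ∈ ends e → e = f) (h3v : a₃ ≠ v)
    {o a₁ a₂ b : V} (ho : o ≠ a₃) (h1 : a₁ ≠ a₃) (h2 : a₂ ≠ a₃) (hb : b ≠ a₃) :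
    T0 p (Function.update ends f s(a₃, a₃)) o a₁ a₂ b = T0 p ends o a₁ a₂ b := by
  unfold T0 mU mUU EQbo EQo gap
  simp only [connEvent_update_loop hf hleaf h3v, avoidAll_update_loop hf hleaf h3v, ho, h1, h2, hb,
    ne_eq, not_false_eq_true]

omit [LinearOrder R] [IsStrictOrderedRing R] in
/-- `CovC` at a marking avoiding the leaf is unchanged by leaf deletion. -/
lemma covC_update_loop (hf : ends f = s(a₃, v)) (hleaf : ∀ e, a₃ ∈ ends e → e = f) (h3v : a₃ ≠ v)
    {o a₁ a₂ w : V} (ho : o ≠ a₃) (h1 : a₁ ≠ a₃) (h2 : a₂ ≠ a₃) (hw : w ≠ a₃) :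
    LeafStep.covC p (Function.update ends f s(a₃, a₃)) o a₁ a₂ w = LeafStep.covC p ends o a₁ a₂ w := by
  unfold LeafStep.covC mU mUU
  simp only [connEvent_update_loop hf hleaf h3v, avoidAll_update_loop hf hleaf h3v, ho, h1, h2, hw,
    ne_eq, not_false_eq_true]

omit [IsStrictOrderedRing R] in
/-- `HCov` is unchanged by leaf deletion. -/
lemma HCov_update_loop (hf : ends f = s(a₃, v)) (hleaf : ∀ e, a₃ ∈ ends e → e = f) (h3v : a₃ ≠ v)
    {o a₁ a₂ w b : V} (ho : o ≠ a₃) (h1 : a₁ ≠ a₃) (h2 : a₂ ≠ a₃) (hw : w ≠ a₃) (hb : b ≠ a₃) :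
    HCov p (Function.update ends f s(a₃, a₃)) o a₁ a₂ w b ↔ HCov p ends o a₁ a₂ w b := by
  unfold HCov
  rw [Gc_update_loop p hf hleaf h3v ho h1 h2 hw hb]

omit [IsStrictOrderedRing R] in
/-- `LeafRow` is unchanged by leaf deletion. -/
lemma LeafRow_update_loop (hf : ends f = s(a₃, v)) (hleaf : ∀ e, a₃ ∈ ends e → e = f)
    (h3v : a₃ ≠ v) {o a₁ a₂ w b : V} (ho : o ≠ a₃) (h1 : a₁ ≠ a₃) (h2 : a₂ ≠ a₃) (hw : w ≠ a₃)
    (hb : b ≠ a₃) :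
    LeafRow p (Function.update ends f s(a₃, a₃)) o a₁ a₂ w b ↔ LeafRow p ends o a₁ a₂ w b := by
  unfold LeafRow
  rw [Rhalf_update_loop p hf hleaf h3v ho h1 h2 hw hb]

omit [IsStrictOrderedRing R] in
/-- `Q1Row` is unchanged by leaf deletion. -/
lemma Q1Row_update_loop (hf : ends f = s(a₃, v)) (hleaf : ∀ e, a₃ ∈ ends e → e = f) (h3v : a₃ ≠ v)
    {o a₁ a₂ w b : V} (ho : o ≠ a₃) (h1 : a₁ ≠ a₃) (h2 : a₂ ≠ a₃) (hw : w ≠ a₃) (hb : b ≠ a₃) :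
    Q1Row p (Function.update ends f s(a₃, a₃)) o a₁ a₂ w b ↔ Q1Row p ends o a₁ a₂ w b := by
  unfold Q1Row
  rw [Gc_update_loop p hf hleaf h3v ho h1 h2 hw hb, covC_update_loop p hf hleaf h3v ho h1 h2 hw,
    T0_update_loop p hf hleaf h3v hb h1 h2 hw, avoidAll_update_loop hf hleaf h3v h1 h2]

end Masses

section Path

variable [Fintype E] [DecidableEq E] [Fintype V] [DecidableEq V] {R : Type*} [Field R]
  [LinearOrder R] [IsStrictOrderedRing R] (p : E → R) (ends : E → Sym2 V)

/-- **The CORRECTED (HCOV) pendant-path theorem**: (HCOV) and the leaf row at `w` give (HCOV) at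
the end `a₃` of the pendant path `a₃ – v – w` (and the leaf row at `v`). -/
theorem HCov_pendant_path' (hp : IsProbVec p) {f g : E} {a₃ v w : V} (hf : ends f = s(a₃, v))
    (hleaf₃ : ∀ e, a₃ ∈ ends e → e = f) (h3v : a₃ ≠ v) (hg : ends g = s(v, w))
    (hdeg : ∀ e, v ∈ ends e → e = g ∨ e = f) (hvw : v ≠ w) (h3w : a₃ ≠ w) {o a₁ a₂ b : V}
    (h31 : a₃ ≠ a₁) (h32 : a₃ ≠ a₂) (ho3 : o ≠ a₃) (hb3 : b ≠ a₃) (hv1 : v ≠ a₁) (hv2 : v ≠ a₂)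
    (hov : o ≠ v) (hbv : b ≠ v) (hHw : HCov p ends o a₁ a₂ w b)
    (hRw : LeafRow p ends o a₁ a₂ w b) :
    HCov p ends o a₁ a₂ a₃ b ∧ LeafRow p ends o a₁ a₂ v b := by
  have hHw' := (HCov_update_loop p hf hleaf₃ h3v ho3 h31.symm h32.symm h3w.symm hb3).2 hHw
  have hRw' := (LeafRow_update_loop p hf hleaf₃ h3v ho3 h31.symm h32.symm h3w.symm hb3).2 hRw
  have hg' := ends_update_loop_of_ne hf h3v hg h3w
  have hleafv' := leaf_update_loop hf h3v hdeg
  have hRv' := leafRow_of_leaf p _ hp hg' hleafv' hvw hv1 hv2 hov hbv hRw'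
  have hHv' := HCov_of_leaf p _ hp hg' hleafv' hvw hv1 hv2 hov hbv hHw' hRw'
  have hRv := (LeafRow_update_loop p hf hleaf₃ h3v ho3 h31.symm h32.symm h3v.symm hb3).1 hRv'
  have hHv := (HCov_update_loop p hf hleaf₃ h3v ho3 h31.symm h32.symm h3v.symm hb3).1 hHv'
  exact ⟨HCov_leaf p ends hp hf hleaf₃ h3v h31 h32 ho3 hb3 hHv hRv, hRv⟩

end Path

/-! ## `(Q1)` is the MARGIN form of the leaf row -/

section Margin

variable {V : Type*} {E : Type*} [Fintype E] [DecidableEq E] [DecidableEq V] {R : Type*} [Field R]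
  [LinearOrder R] [IsStrictOrderedRing R] (p : E → R) (ends : E → Sym2 V)

/-- The (Q1) expression factors through the pole identity:
`P(Q)² Gc(v) + CovC(o, v) T₀(b, v) = D_v · (2 P(Q) R½ − D_v T₀)`. -/
theorem Q1_expr_eq (o a₁ a₂ v b : V) :
    prob p (avoidAll ends a₂ {a₁}) ^ 2 * Gc p ends o a₁ a₂ v b +
        LeafStep.covC p ends o a₁ a₂ v * T0 p ends b a₁ a₂ v =
      prob p (PDEvent ends a₁ a₂ v) *
        (2 * prob p (avoidAll ends a₂ {a₁}) * Rhalf p ends o a₁ a₂ v b -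
          prob p (PDEvent ends a₁ a₂ v) * T0 p ends o a₁ a₂ b) := by
  have h := Rhalf_pole_identity p ends o a₁ a₂ v b
  linear_combination -h

/-- **`(Q1)` at `a₃ := v` is the leaf row with the margin `½ · P(Q, v ∉ U)/P(Q) · T₀`**:
for `D_v = P(Q, v ∉ U) > 0`, `Q1Row ↔ D_v · T₀ ≤ 2 P(Q) · R½` — i.e. the first-order (`q → 0`) form
of the pendant monotonicity `G(q) ≥ (1 − q) G(0)` at a leaf attached to `v`. -/
theorem Q1Row_iff_margin (o a₁ a₂ v b : V) (hD : 0 < prob p (PDEvent ends a₁ a₂ v)) :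
    Q1Row p ends o a₁ a₂ v b ↔
      prob p (PDEvent ends a₁ a₂ v) * T0 p ends o a₁ a₂ b ≤
        2 * prob p (avoidAll ends a₂ {a₁}) * Rhalf p ends o a₁ a₂ v b := by
  unfold Q1Row
  rw [Q1_expr_eq]
  constructor
  · intro h
    have := (mul_nonneg_iff_of_pos_left hD).1 h
    linarith
  · intro h
    exact mul_nonneg hD.le (by linarith)

end Margin

end LeafDelete

end Summit.Ventures.PercRepro2
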